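import Literature.NumberTheory.EllipticCurves.AnticyclotomicPrimeDecomposition
import Literature.NumberTheory.EllipticCurves.ZpExtensionUnramifiedProofs
import Literature.NumberTheory.EllipticCurves.ZpExtensionProofs
import Literature.NumberTheory.EllipticCurves.ZpExtensionLayerCharacter
import Literature.NumberTheory.NumberFields.HilbertClassFieldMaximal
import Literature.NumberTheory.NumberFields.UnramifiedCompositum
import Literature.NumberTheory.GaloisRepresentations.AbsIntegersEquiv
import Literature.NumberTheory.GaloisRepresentations.DecompositionGroupOfCompletion
import Literature.NumberTheory.GaloisRepresentations.IntegralGaloisActionProofs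
import HarnessLib

/-!
# Brink 2007, Corollary 1: the primes above `p` do not split completely in the anticyclotomic
# `ℤ_p`-extension — discharge of `ZpExtension.decomp_not_le_kerSubgroup_above_of_isAnticyclotomic`

Topic `NumberTheory/EllipticCurves` (Iwasawa theory of `ℤ_p`-extensions); namespace
`Literature.NumberTheory.EllipticCurves.ZpExtension`.  `Proofs` file: theorems only, no definition,
no named fact (D-0026).

The named fact `ZpExtension.decomp_not_le_kerSubgroup_above_of_isAnticyclotomic K p`
(`AnticyclotomicPrimeDecomposition.lean`) transcribes D. Brink, *Prime decomposition in the
anti-cyclotomic extension*, Math. Comp. 76 (2007), Cor. 1 (p. 2136) at the prime `p` itself: for an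
odd prime `p`, an imaginary quadratic field `K`, an anticyclotomic `ℤ_p`-extension
`κ : Γ_K ↠ ℤ_p` (`ZpExtension.IsAnticyclotomic`) and a finite place `v ∣ p` of `K`, the
decomposition group `D_v ≤ Γ_K` of the chosen prime of `K̄` above `v` (`GreenbergSelmer.decomp v`)
is NOT contained in `ker κ = Gal(K̄/K_∞)` — `v` does not split completely in `K_∞`.

## The printed proof and the proof given here

Brink (p. 2136): "The prime `l` is (infinitely) ramified in `K^anti`, since otherwise `K^anti`
would be an infinite unramified extension of `K`, contradicting the finiteness of the class
number."  We follow this, with the one step the print leaves to the reader made explicit: that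
`K^anti` is unramified at EVERY prime of `K` above `p` as soon as `D_v ≤ ker κ` for ONE of them
(when `p` splits in `K` there are two, exchanged by `Gal(K/ℚ)`; `K^anti/ℚ` being Galois —
pro-dihedral — ramification at one is ramification at the other).

1. **The chosen prime** (`inertia_adicCompletionPrime_le_decomp`).  For the prime
   `𝔓₀ = adicCompletionPrime K v` of `\bar ℤ_K` cut out by the chosen embedding `K̄ → \bar K_v`,
   `I_{𝔓₀} ≤ D_{𝔓₀} = D_v` (tree: `Ideal.inertia_le_decompositionSubgroup`,
   `decompositionSubgroup_adicCompletionPrime_eq_range`, Neukirch II (9.6)); so the hypothesis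
   `D_v ≤ ker κ` gives `I_{𝔓₀} ≤ ker κ`.
2. **Every prime above `p`** (`inertia_le_kerSubgroup_of_natCast_mem_of_decomp_le`).  Let `𝔓` be
   any prime of `\bar ℤ_K` above a place `w ∣ p`.  Contract `𝔓` and `𝔓₀` along the chosen
   isomorphism `ι : \bar ℤ_ℚ ≅ \bar ℤ_K` (`absIntegersMap ℚ K`, file `AbsIntegersEquiv`): both
   contractions lie above the place `(p)` of `ℚ`, so `Γ_ℚ` moves one to the other
   (`exists_smul_eq_of_mem_primesAbove_holds`, Neukirch I (9.1)): `ρ • ι⁻¹𝔓₀ = ι⁻¹𝔓`.  For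
   `τ ∈ I_𝔓` the element `ρ⁻¹ (res τ) ρ` lies in `I_{ι⁻¹𝔓₀}`, and it is `res σ` for some
   `σ ∈ Γ_K` — either because `ρ = res σ₀` is itself a restriction (`σ = σ₀⁻¹ τ σ₀`), or, when
   `ρ ∉ res(Γ_K)`, because `res(Γ_K)` has index two in `Γ_ℚ`
   (`inv_mul_mem_range_absGaloisRestrict`, `[K : ℚ] = 2`).  Then `σ ∈ I_{𝔓₀}`
   (`comap_inertia_comap_absIntegersMap`), so `κ σ = 1` by step 1, and `κ τ = κ σ` in the first
   case (`ℤ_p` is abelian), `κ τ = (κ σ)⁻¹` in the second — this is exactly the defining property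
   of an ANTICYCLOTOMIC `κ` (`ZpExtension.IsAnticyclotomic`: every `ρ ∈ Γ_ℚ ∖ Γ_K` acts on
   `Gal(K_∞/K)` by `-1`; Brink §II Prop. 1: `K^anti` is pro-dihedral over `ℚ`).  Either way
   `κ τ = 1`.  Away from `p` the inertia groups lie in `ker κ` by the tree's theorem
   `ZpExtension.inertia_le_kerSubgroup_holds` (a `ℤ_p`-extension is unramified outside `p`,
   Washington Prop. 13.2; file `ZpExtensionUnramifiedProofs`).
3. **Finiteness of the class number** (`decomp_not_le_kerSubgroup_above_of_isAnticyclotomic_holds`).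
   Hence every layer `K_n = K̄^{κ⁻¹(pⁿℤ_p)}` is a finite abelian extension of `K`
   (`isAbelianGalois_layer`) unramified at every finite place
   (`isUnramifiedIn_iff_forall_inertia_absRestrictNormalHom_eq_one`, Neukirch VII §10) and at the
   infinite places (`[K_n : K] = pⁿ` is odd), so `pⁿ = [K_n : K]` divides the class number `h_K`
   (`hilbertClassField.finrank_dvd_classNumber_of_abelian`: `K_n` lies in the Hilbert class field,
   Cox Thm. 8.10 / Cor. 5.24) for every `n` — impossible for `pⁿ > h_K`.

The hypothesis `p ≠ 2` of the fact is used only cosmetically (oddness of `[K_n : K]` gives the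
unramifiedness at infinity; for a totally complex `K` it holds anyway), and of
`IsImaginaryQuadratic K` only `[K : ℚ] = 2` is used.

## Main statements

* `ZpExtension.inertia_adicCompletionPrime_le_decomp` — `I_{𝔓₀} ≤ D_v`.
* `ZpExtension.inertia_le_kerSubgroup_of_natCast_mem_of_decomp_le` — step 2.
* `ZpExtension.isUnramifiedIn_layer_of_forall_inertia_le` — if all inertia groups of `Γ_K` lie in
  `ker κ`, every layer `K_n/K` is unramified at every finite place.
* `ZpExtension.decomp_not_le_kerSubgroup_above_of_isAnticyclotomic_holds` — the discharge
  (for `K : Type`, the universe of the tree's Hilbert class field theory and of every consumer).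

## References

* [Brink2007] D. Brink, *Prime decomposition in the anti-cyclotomic extension*, Math. Comp. 76
  (2007), 2127–2138: Cor. 1 and its proof (p. 2136), §II Prop. 1 (p. 2130).  Held:
  `paper:doi-10-1090-s0025-5718-07-01964-3`, PDF p. 7 (Cor. 1), p. 3 (Prop. 1).
* [Washington1997] L. C. Washington, *Introduction to Cyclotomic Fields*, 2nd ed., GTM 83,
  §13.1, Prop. 13.2.
* [NeukirchANT1999] J. Neukirch, *Algebraic Number Theory*, Ch. I §9 (9.1), Ch. II §9 (9.6),
  Ch. VI §6 (6.9), Ch. VII §10.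
* [Cox2013] D. A. Cox, *Primes of the form x² + ny²*, 2nd ed., §5.C Cor. 5.24, §8.A Thm. 8.10.
-/

noncomputable section

open scoped Pointwise
open Field NumberField IsDedekindDomain

universe u

namespace Literature.NumberTheory.EllipticCurves.ZpExtension

open Literature.NumberTheory.GaloisRepresentations Literature.NumberTheory.NumberFields

/-! ### Step 1: the chosen prime above `v` -/

section ChosenPrime

variable {K : Type u} [Field K] [NumberField K]

/-- **`I_{𝔓₀} ≤ D_v`**: the inertia group of the prime `𝔓₀ = adicCompletionPrime K v` of `\bar ℤ_K`
cut out by the chosen embedding `K̄ → \bar K_v` is contained in the decomposition group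
`D_v = res(Γ_{K_v})` of the tree (`GreenbergSelmer.decomp v`), because `I_{𝔓₀} ≤ D_{𝔓₀}` and
`D_{𝔓₀} = res(Γ_{K_v})` (Neukirch, *Algebraic Number Theory*, Ch. I §9 (9.6) and Ch. II §9
Prop. (9.6)). [cite: NeukirchANT1999, Ch. II §9 Prop. (9.6)] -/
theorem inertia_adicCompletionPrime_le_decomp (v : HeightOneSpectrum (𝓞 K)) :
    (adicCompletionPrime K v).inertia (absoluteGaloisGroup K) ≤ GreenbergSelmer.decomp v := by
  intro g hg
  have h := Ideal.inertia_le_decompositionSubgroup (absoluteGaloisGroup K)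
    (adicCompletionPrime K v) hg
  rw [decompositionSubgroup_adicCompletionPrime_eq_range] at h
  exact h

end ChosenPrime

/-! ### Step 2: every prime above `p` -/

section AboveP

/-- The finite places of `ℚ` containing a given rational prime coincide (`𝓞 ℚ ≅ ℤ`, Mathlib
`Rat.HeightOneSpectrum.primesEquiv`). [folklore] -/
private theorem rat_heightOneSpectrum_eq_of_natCast_mem {u u' : HeightOneSpectrum (𝓞 ℚ)} {p : ℕ}
    (hp : p.Prime) (hu : (p : 𝓞 ℚ) ∈ u.asIdeal) (hu' : (p : 𝓞 ℚ) ∈ u'.asIdeal) : u = u' := by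
  have key : ∀ u : HeightOneSpectrum (𝓞 ℚ), (p : 𝓞 ℚ) ∈ u.asIdeal →
      Rat.HeightOneSpectrum.natGenerator u = p := fun u h ↦ by
    have h1 : Rat.HeightOneSpectrum.natGenerator u ∣ p := by
      rw [Rat.HeightOneSpectrum.natGenerator_dvd_iff]
      have h2 := Ideal.mem_map_of_mem (Rat.IsIntegralClosure.intEquiv (𝓞 ℚ)) h
      rwa [map_natCast] at h2
    exact (Nat.prime_dvd_prime_iff_eq (Rat.HeightOneSpectrum.prime_natGenerator u) hp).mp h1
  apply (Rat.HeightOneSpectrum.primesEquiv (R := 𝓞 ℚ)).injective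
  exact Subtype.ext ((key u hu).trans (key u' hu').symm)

/-- A place of a number field containing the rational prime `p` lies above the place `(p)` of `ℚ`:
`(p : 𝓞 ℚ) ∈ 𝔭_w ∩ 𝓞 ℚ`. [folklore] -/
private theorem natCast_mem_under_rat {K : Type u} [Field K] [NumberField K]
    {w : HeightOneSpectrum (𝓞 K)} {p : ℕ} (hpw : ((p : ℕ) : 𝓞 K) ∈ w.asIdeal) :
    (p : 𝓞 ℚ) ∈ (w.under (𝓞 ℚ)).asIdeal := by
  rw [HeightOneSpectrum.under_asIdeal, Ideal.under_def, Ideal.mem_comap, map_natCast]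
  exact hpw

variable {K : Type u} [Field K] [NumberField K] {p : ℕ} [Fact p.Prime]

/-- **Step 2 (Brink 2007, proof of Cor. 1, the symmetric step): if the decomposition group of ONE
prime above `p` lies in `ker κ` for an anticyclotomic `κ`, then the inertia group of EVERY prime
of `\bar ℤ_K` above ANY place `w ∣ p` lies in `ker κ`.**  Here `[K : ℚ] = 2`, `κ : Γ_K ↠ ℤ_p` is
anticyclotomic (`IsAnticyclotomic`: every `ρ ∈ Γ_ℚ ∖ Γ_K` acts on it by `-1`), `v ∣ p` with
`D_v ≤ ker κ`, and `𝔓 ∣ w ∣ p`.  Proof (module docstring, step 2): contract along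
`ι : \bar ℤ_ℚ ≅ \bar ℤ_K`; `Γ_ℚ` is transitive on the primes of `\bar ℤ_ℚ` above `(p)`
(Neukirch I (9.1)), say `ρ • ι⁻¹𝔓₀ = ι⁻¹𝔓`; for `τ ∈ I_𝔓`, `ρ⁻¹ (res τ) ρ = res σ` with
`σ ∈ I_{𝔓₀} ≤ ker κ` (index two of `res(Γ_K)` in `Γ_ℚ` when `ρ ∉ res(Γ_K)`), and `κ τ = κ σ = 1` or
`κ τ = (κ σ)⁻¹ = 1` according as `ρ ∈ res(Γ_K)` or not — the second by anticyclotomicity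
(Brink §II Prop. 1: `K^anti/ℚ` is pro-dihedral). [cite: Brink2007, Cor. 1 (p. 2136) and §II Prop. 1 (p. 2130)]
[cite: NeukirchANT1999, Ch. I §9 Prop. (9.1)] -/
theorem inertia_le_kerSubgroup_of_natCast_mem_of_decomp_le (hK : Module.finrank ℚ K = 2)
    (κ : ZpExtension K p) (hκ : κ.IsAnticyclotomic)
    {v : HeightOneSpectrum (𝓞 K)} (hpv : ((p : ℕ) : 𝓞 K) ∈ v.asIdeal)
    (hv : GreenbergSelmer.decomp v ≤ κ.kerSubgroup)
    {w : HeightOneSpectrum (𝓞 K)} (hpw : ((p : ℕ) : 𝓞 K) ∈ w.asIdeal)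
    {𝔓 : Ideal (absIntegers (𝓞 K) K)} (h𝔓 : 𝔓 ∈ w.primesAbove) :
    𝔓.inertia (absoluteGaloisGroup K) ≤ κ.kerSubgroup := by
  have hp : p.Prime := Fact.out
  -- the chosen prime above `v` and its inertia group
  have h𝔓₀ : adicCompletionPrime K v ∈ v.primesAbove := adicCompletionPrime_mem_primesAbove K v
  have hI₀ : (adicCompletionPrime K v).inertia (absoluteGaloisGroup K) ≤ κ.kerSubgroup :=
    (inertia_adicCompletionPrime_le_decomp v).trans hv
  -- the place `(p)` of `ℚ` below `v` and `w`
  have hvu : v.asIdeal.under (𝓞 ℚ) = (v.under (𝓞 ℚ)).asIdeal :=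
    (HeightOneSpectrum.under_asIdeal (𝓞 ℚ) v).symm
  have hwu : w.asIdeal.under (𝓞 ℚ) = (v.under (𝓞 ℚ)).asIdeal := by
    rw [← rat_heightOneSpectrum_eq_of_natCast_mem hp (natCast_mem_under_rat hpw)
      (natCast_mem_under_rat hpv)]
    exact (HeightOneSpectrum.under_asIdeal (𝓞 ℚ) w).symm
  -- the contracted primes of `\bar ℤ_ℚ` and the transporting element `ρ ∈ Γ_ℚ`
  have h𝔔 : 𝔓.comap (absIntegersMap ℚ K) ∈ (v.under (𝓞 ℚ)).primesAbove :=
    comap_absIntegersMap_mem_primesAbove hwu h𝔓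
  have h𝔔₀ : (adicCompletionPrime K v).comap (absIntegersMap ℚ K) ∈ (v.under (𝓞 ℚ)).primesAbove :=
    comap_absIntegersMap_mem_primesAbove hvu h𝔓₀
  obtain ⟨ρ, hρ⟩ := HeightOneSpectrum.exists_smul_eq_of_mem_primesAbove_holds h𝔔₀ h𝔔
  intro τ hτ
  -- `ρ⁻¹ (res τ) ρ ∈ I_{ι⁻¹ 𝔓₀}`
  have h1 : absGaloisRestrict ℚ K τ ∈
      (ρ • (adicCompletionPrime K v).comap (absIntegersMap ℚ K)).inertia (absoluteGaloisGroup ℚ) := by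
    rw [hρ]
    exact absGaloisRestrict_mem_inertia_comap ℚ K hτ
  have h2 : ρ⁻¹ * absGaloisRestrict ℚ K τ * ρ ∈
      ((adicCompletionPrime K v).comap (absIntegersMap ℚ K)).inertia (absoluteGaloisGroup ℚ) :=
    (HeightOneSpectrum.mem_inertia_smul_absIntegers_iff ρ _ _).mp h1
  -- any `σ ∈ Γ_K` restricting to it lies in `I_{𝔓₀}`, hence in `ker κ`
  have key : ∀ σ : absoluteGaloisGroup K,
      absGaloisRestrict ℚ K σ = ρ⁻¹ * absGaloisRestrict ℚ K τ * ρ → κ σ = 1 := by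
    intro σ hσ
    have h3 : σ ∈ (adicCompletionPrime K v).inertia (absoluteGaloisGroup K) := by
      rw [← comap_inertia_comap_absIntegersMap ℚ K (adicCompletionPrime K v), Subgroup.mem_comap]
      change absGaloisRestrict ℚ K σ ∈ _
      rw [hσ]
      exact h2
    exact mem_kerSubgroup.mp (hI₀ h3)
  rw [mem_kerSubgroup]
  by_cases hρr : ρ ∈ Set.range (absGaloisRestrict ℚ K)
  · -- `ρ = res σ₀`: `σ = σ₀⁻¹ τ σ₀ ∈ I_{𝔓₀}` and `κ τ = κ σ`
    obtain ⟨σ₀, rfl⟩ := hρr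
    have hσ : absGaloisRestrict ℚ K (σ₀⁻¹ * τ * σ₀) =
        (absGaloisRestrict ℚ K σ₀)⁻¹ * absGaloisRestrict ℚ K τ * absGaloisRestrict ℚ K σ₀ := by
      rw [map_mul, map_mul, map_inv]
    have h4 := key _ hσ
    rwa [map_mul, map_mul, map_inv, mul_comm (κ σ₀)⁻¹ (κ τ), mul_assoc, inv_mul_cancel,
      mul_one] at h4
  · -- `ρ ∉ res(Γ_K)`: index two gives `σ`, anticyclotomicity gives `κ τ = (κ σ)⁻¹`
    have hρ' : absGaloisRestrict ℚ K τ * ρ ∉ Set.range (absGaloisRestrict ℚ K) := by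
      rintro ⟨σ', hσ'⟩
      exact hρr ⟨τ⁻¹ * σ', by rw [map_mul, map_inv, hσ', ← mul_assoc, inv_mul_cancel, one_mul]⟩
    obtain ⟨σ, hσ⟩ := inv_mul_mem_range_absGaloisRestrict hK hρr hρ'
    have hσ' : absGaloisRestrict ℚ K σ = ρ⁻¹ * absGaloisRestrict ℚ K τ * ρ := by
      rw [hσ, mul_assoc]
    have h4 := key σ hσ'
    have h5 : κ τ = (κ σ)⁻¹ := hκ σ τ ρ hρr (by rw [hσ']; group)
    rw [h5, h4, inv_one]

/-- **All inertia groups lie in `ker κ`** under the hypotheses of step 2: above `p` by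
`inertia_le_kerSubgroup_of_natCast_mem_of_decomp_le`, away from `p` because a `ℤ_p`-extension is
unramified outside `p` (`ZpExtension.inertia_le_kerSubgroup_holds`, Washington Prop. 13.2).
[cite: Washington1997, §13.1 Prop. 13.2] [cite: Brink2007, Cor. 1 (p. 2136)] -/
theorem inertia_le_kerSubgroup_of_decomp_le (hK : Module.finrank ℚ K = 2)
    (κ : ZpExtension K p) (hκ : κ.IsAnticyclotomic)
    {v : HeightOneSpectrum (𝓞 K)} (hpv : ((p : ℕ) : 𝓞 K) ∈ v.asIdeal)
    (hv : GreenbergSelmer.decomp v ≤ κ.kerSubgroup)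
    (w : HeightOneSpectrum (𝓞 K)) {𝔓 : Ideal (absIntegers (𝓞 K) K)} (h𝔓 : 𝔓 ∈ w.primesAbove) :
    𝔓.inertia (absoluteGaloisGroup K) ≤ κ.kerSubgroup := by
  by_cases hpw : ((p : ℕ) : 𝓞 K) ∈ w.asIdeal
  · exact inertia_le_kerSubgroup_of_natCast_mem_of_decomp_le hK κ hκ hpv hv hpw h𝔓
  · exact inertia_le_kerSubgroup_holds K p κ hpw h𝔓

end AboveP

/-! ### Step 3: unramified layers and the class number -/

section ClassNumber

variable {K : Type} [Field K] [NumberField K] {p : ℕ} [Fact p.Prime]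

/-- **A `ℤ_p`-extension all of whose inertia groups lie in `ker κ` has every layer `K_n/K`
unramified at every finite place**: `I_𝔓 ≤ ker κ ≤ κ⁻¹(pⁿ ℤ_p) = Gal(K̄/K_n)` fixes `K_n`, so
`I_𝔓` dies in `Gal(K_n/K)`, which is unramifiedness at the place below `𝔓` (Neukirch VII §10,
proof of (10.6), tree `isUnramifiedIn_iff_forall_inertia_absRestrictNormalHom_eq_one`).
[cite: NeukirchANT1999, Ch. VII §10 Thm. (10.6) (proof)] [cite: Washington1997, §13.1] -/
theorem isUnramifiedIn_layer_of_forall_inertia_le (κ : ZpExtension K p)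
    (h : ∀ (w : HeightOneSpectrum (𝓞 K)) (𝔓 : Ideal (absIntegers (𝓞 K) K)),
      𝔓 ∈ w.primesAbove → 𝔓.inertia (absoluteGaloisGroup K) ≤ κ.kerSubgroup)
    (n : ℕ) (w : HeightOneSpectrum (𝓞 K)) :
    Algebra.IsUnramifiedIn (𝓞 (κ.layer n)) w.asIdeal := by
  haveI : FiniteDimensional K (κ.layer n) := κ.finiteDimensional_layer_holds n
  haveI : IsGalois K (κ.layer n) := κ.isGalois_layer_holds n
  rw [isUnramifiedIn_iff_forall_inertia_absRestrictNormalHom_eq_one]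
  intro 𝔓 h𝔓 g hg
  have hg' : g ∈ κ.layerSubgroup n := κ.kerSubgroup_le_layerSubgroup n (h w 𝔓 h𝔓 hg)
  rw [absRestrictNormalHom_eq_one_iff_forall_smul]
  intro x
  have hfix : absoluteGaloisGroup.toAlgEquiv K g ∈ (κ.layer n).fixingSubgroup := by
    rw [κ.fixingSubgroup_layer n]
    exact ⟨g, hg', rfl⟩
  rw [IntermediateField.mem_fixingSubgroup_iff] at hfix
  rw [absoluteGaloisGroup.smul_def]
  exact hfix x x.2

variable (K p) in
/-- **Discharge of `ZpExtension.decomp_not_le_kerSubgroup_above_of_isAnticyclotomic` (Brink 2007,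
Cor. 1 at the prime `p`): the primes above `p` of an imaginary quadratic field do not split
completely in its anticyclotomic `ℤ_p`-extension.**  Printed proof (p. 2136): "The prime `l` is
(infinitely) ramified in `K^anti`, since otherwise `K^anti` would be an infinite unramified
extension of `K`, contradicting the finiteness of the class number."  Here: if `D_v ≤ ker κ` for
some `v ∣ p`, then every inertia group of `Γ_K` lies in `ker κ` (step 2,
`inertia_le_kerSubgroup_of_decomp_le`, using the anticyclotomic symmetry for the other prime above
a split `p` and Washington Prop. 13.2 away from `p`), so every layer `K_n/K` — abelian of degree
`pⁿ` (`isAbelianGalois_layer`, `finrank_layer_holds`), unramified at all finite places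
(`isUnramifiedIn_layer_of_forall_inertia_le`) and at infinity (`pⁿ` odd) — has degree dividing
the class number (`hilbertClassField.finrank_dvd_classNumber_of_abelian`, Cox Cor. 5.24 /
Thm. 8.10: `K_n` lies in the Hilbert class field); `pⁿ ∣ h_K` for all `n` is absurd.  Stated for
`K : Type`, the universe of the tree's Hilbert class field and of every consumer.
[cite: Brink2007, Cor. 1 (p. 2136) and its proof] [cite: Cox2013, §5.C Cor. 5.24 and §8.A Thm. 8.10]
[cite: Washington1997, §13.1 Prop. 13.2] -/
theorem decomp_not_le_kerSubgroup_above_of_isAnticyclotomic_holds :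
    decomp_not_le_kerSubgroup_above_of_isAnticyclotomic K p := by
  intro hK hp2 κ hκ v hpv hle
  have hp : p.Prime := Fact.out
  have hI : ∀ (w : HeightOneSpectrum (𝓞 K)) (𝔓 : Ideal (absIntegers (𝓞 K) K)),
      𝔓 ∈ w.primesAbove → 𝔓.inertia (absoluteGaloisGroup K) ≤ κ.kerSubgroup :=
    fun w _ h𝔓 ↦ inertia_le_kerSubgroup_of_decomp_le hK.1 κ hκ hpv hle w h𝔓
  -- every layer has degree `pⁿ` dividing the class number
  have hdvd : ∀ n : ℕ, p ^ n ∣ Fintype.card (ClassGroup (𝓞 K)) := by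
    intro n
    haveI : FiniteDimensional K (κ.layer n) := κ.finiteDimensional_layer_holds n
    haveI : IsGalois K (κ.layer n) := κ.isGalois_layer_holds n
    haveI : IsAbelianGalois K (κ.layer n) := κ.isAbelianGalois_layer n
    haveI : NumberField (κ.layer n) := NumberField.of_module_finite K (κ.layer n)
    haveI : IsUnramifiedAtInfinitePlaces K (κ.layer n) :=
      IsUnramifiedAtInfinitePlaces_of_odd_finrank
        (by rw [κ.finrank_layer_holds n]; exact (hp.odd_of_ne_two hp2).pow)
    have h := hilbertClassField.finrank_dvd_classNumber_of_abelian K (κ.layer n)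
      (fun w ↦ isUnramifiedIn_layer_of_forall_inertia_le κ hI n w)
    rwa [κ.finrank_layer_holds n] at h
  -- but `p ^ h_K > h_K`
  have hpos : 0 < Fintype.card (ClassGroup (𝓞 K)) := Fintype.card_pos
  exact absurd (Nat.le_of_dvd hpos (hdvd _)) (not_le.mpr (Nat.lt_pow_self hp.one_lt))

end ClassNumber

end Literature.NumberTheory.EllipticCurves.ZpExtension

end
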